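import Summits.ABC.StewartYu.PadicG3TwoOfData
import Summits.ABC.StewartYu.PadicG3TwoFeldmanBasis
import HarnessLib

/-!
# Cell abc-stewartyu, Gen-3 frame at `p = 2` (crux `Y07Two`, stmt-ABC-19659), layer F7: the FRAME ASSEMBLY —
# `FrameTwoLast C d` from the levels' output (native identities at the last level) and the record, with the
# Fel'dman basis `Rᵢ = Δ(Y₀; ℓ₀(i), H)`

`Summits/ABC/StewartYu/PadicG3TwoFrameAssembly.lean` — cell `abc-stewartyu` (HOME `run/shared/lean/pub/abc-stewartyu/`),
route `PadicPrimesKummerThird`, seat p3 (g5), F-two LEAD (memo-09 §9 recipe).  Theorems.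

The unknowns of the frame are indexed by `ι = ℕ × ((Fin d → ℤ) × ℤ)`: `i = (ℓ₀, (u, u_θ))`, with `Y₀`-factor
`Rᵢ = feldR ℓ₀ H = Δ(Y₀; ℓ₀, H)` (`PadicG3TwoFeldmanBasis`) and signed exponents `(u, u_θ)`.  Two facts close the
`Y₀`-side hypotheses of the END bridge once and for all:
* `natDegree_feldR_eq : natDegree (feldR ℓ H) = ℓ` with leading coefficient `(den ℓ H)⁻¹` (`num` is monic) ⇒
  the basis is DEGREE-TRIANGULAR, so a nonzero coefficient vector `p` on `B` has a nonzero `κ`-fibre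
  `∑_{i ∈ B, κᵢ = κ₀} pᵢ·Rᵢ ≠ 0` (`exists_fibre_ne_zero`) — the `hne` of `frameOutputTwo_of_hasseIdentities`;
* `natDegree_feldR_le` bounds the degrees by `D₀` when `ℓ₀ ≤ D₀` on `B`.
`frameTwoLast_of_levels` then ASSEMBLES `GenThreeFramePivotTwo.FrameTwoLast C d` from: for every pivot-last datum
under the negated bound, parameters `(H, D₀, S₀, X, Dbox, D_θ)`, a box `B` and integer coefficients `p ≠ 0`
supported on `B` such that the NATIVE IDENTITIES `(ofData …).g3φ τ x = 0` hold for `|x| ≤ (d+2)X`,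
`|τ| ≤ (d+2)S₀` (= the output of the levels F3/F4/F5/F6 on the set-up `TwoSetup.ofData`), and the record's
`RecordTwo C (d+1) V Vmax W D₀ S₀ X (snoc Dbox D_θ)`.

WHAT THIS IS NOT: the levels and the record themselves; no crux moves.

References: Yu. V. Nesterenko, LNM 1819 (2003), §3.1 (3.1), §5.1; K. Yu, Acta Math. 211 (2013), §6.
-/

noncomputable section

open Finset Polynomial
open Literature.NumberTheory.Transcendental
open Literature.NumberTheory.Transcendental (FeldmanDelta.num FeldmanDelta.den)
open Literature.NumberTheory.Transcendental.FeldmanDelta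
open Literature.NumberTheory.Transcendental.CW77.Setup (Tau tauNorm)

namespace Summit.ABC.StewartYu.FeldmanBasis

/-! ### The basis is degree-triangular -/

/-- `num ℚ ℓ H` is monic. [folklore] -/
theorem monic_num (ℓ H : ℕ) : (num ℚ ℓ H).Monic := by
  unfold FeldmanDelta.num
  exact monic_prod_of_monic _ _ fun i _ => monic_X_add_C _

/-- `natDegree (num ℚ ℓ H) = ℓ`. [folklore] -/
theorem natDegree_num_eq (ℓ H : ℕ) : (num ℚ ℓ H).natDegree = ℓ := by
  unfold FeldmanDelta.num
  rw [natDegree_prod_of_monic _ _ fun i _ => monic_X_add_C _,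
    Finset.sum_congr rfl fun i _ => natDegree_X_add_C _, Finset.sum_const, Finset.card_range, smul_eq_mul,
    mul_one]

/-- The coefficient of `Y₀^k` in `feldR ℓ H` vanishes for `k > ℓ` and is `den⁻¹ ≠ 0` for `k = ℓ`. [folklore] -/
theorem coeff_feldR_of_lt {ℓ H k : ℕ} (h : ℓ < k) : (feldR ℓ H).coeff k = 0 :=
  coeff_eq_zero_of_natDegree_lt (lt_of_le_of_lt (natDegree_feldR_le ℓ H) h)

/-- The top coefficient of `feldR ℓ H` is `(den ℓ H)⁻¹`. [folklore] -/
theorem coeff_feldR_self (ℓ H : ℕ) : (feldR ℓ H).coeff ℓ = ((den ℓ H : ℚ))⁻¹ := by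
  unfold feldR
  rw [coeff_C_mul]
  have h := (monic_num ℓ H).coeff_natDegree
  rw [natDegree_num_eq] at h
  rw [h, mul_one]

/-- **A nonzero coefficient vector on a box has a nonzero `κ`-fibre** (degree-triangularity of the Fel'dman
basis): for `B ⊂ ℕ × K` finite and `p` with some `p i₀ ≠ 0`, `i₀ ∈ B`, the fibre of `κ₀ = i₀.2` satisfies
`∑_{i ∈ B, i.2 = κ₀} pᵢ·feldR i.1 H ≠ 0`. [folklore] -/
theorem exists_fibre_ne_zero {K : Type*} [DecidableEq K] (H : ℕ) (B : Finset (ℕ × K)) (p : ℕ × K → ℤ)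
    {i₀ : ℕ × K} (hi₀ : i₀ ∈ B) (hp : p i₀ ≠ 0) :
    ∃ κ₀ : K, ∑ i ∈ B.filter (fun i => i.2 = κ₀), (p i : ℚ) • feldR i.1 H ≠ 0 := by
  classical
  refine ⟨i₀.2, ?_⟩
  set F : Finset (ℕ × K) := B.filter (fun i => i.2 = i₀.2) with hF
  -- the unknowns of the fibre with nonzero coefficient, and their largest `ℓ₀`
  set G : Finset (ℕ × K) := F.filter (fun i => p i ≠ 0) with hG
  have hi₀G : i₀ ∈ G := by
    rw [hG, mem_filter, hF, mem_filter]; exact ⟨⟨hi₀, rfl⟩, hp⟩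
  have hGne : G.Nonempty := ⟨i₀, hi₀G⟩
  obtain ⟨im, himG, hmax⟩ := Finset.exists_max_image G (fun i => i.1) hGne
  set ℓm : ℕ := im.1 with hℓm
  -- the coefficient of `Y₀^{ℓm}` of the fibre sum is `p im / den`
  intro h0
  have hc := congrArg (fun q : ℚ[X] => q.coeff ℓm) h0
  simp only [finsetSum_coeff, coeff_smul, coeff_zero, smul_eq_mul] at hc
  -- split off `im`
  have himF : im ∈ F := (mem_filter.mp himG).1
  rw [← Finset.add_sum_erase F _ himF] at hc
  have hrest : ∑ i ∈ F.erase im, (p i : ℚ) * (feldR i.1 H).coeff ℓm = 0 := by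
    refine Finset.sum_eq_zero fun i hi => ?_
    obtain ⟨hne, hiF⟩ := Finset.mem_erase.mp hi
    by_cases hpi : p i = 0
    · rw [hpi, Int.cast_zero, zero_mul]
    · -- `i ∈ G`, `i ≠ im`, same `κ` ⇒ `i.1 < ℓm`
      have hiG : i ∈ G := by rw [hG, mem_filter]; exact ⟨hiF, hpi⟩
      have hle : i.1 ≤ ℓm := hmax i hiG
      have hlt : i.1 < ℓm := by
        rcases Nat.lt_or_ge i.1 ℓm with h | h
        · exact h
        · exfalso; apply hne
          have h1 : i.1 = im.1 := le_antisymm hle h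
          have h2 : i.2 = im.2 := by
            rw [(mem_filter.mp hiF).2, (mem_filter.mp himF).2]
          exact Prod.ext h1 h2
      rw [coeff_feldR_of_lt hlt, mul_zero]
  rw [hrest, add_zero, coeff_feldR_self] at hc
  have hden : ((den ℓm H : ℚ))⁻¹ ≠ 0 := inv_ne_zero (by exact_mod_cast den_ne_zero ℓm H)
  have hpim : (p im : ℚ) ≠ 0 := by exact_mod_cast (mem_filter.mp himG).2
  exact mul_ne_zero hpim hden hc

end Summit.ABC.StewartYu.FeldmanBasis

namespace Summit.ABC.StewartYu.TwoSetup

open Summit.ABC.StewartYu.FeldmanBasis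

/-! ### The assembly -/

set_option maxHeartbeats 800000 in
/-- **`FrameTwoLast C d` FROM THE LEVELS' OUTPUT AND THE RECORD.**  If for every pivot-last datum under the
negated bound there are `(H, D₀, S₀, X, Dbox, D_θ)`, a box `B ⊂ ℕ × ((Fin d → ℤ) × ℤ)` (`ℓ₀ ≤ D₀`, `|uⱼ| ≤ Dboxⱼ`,
`|u_θ| ≤ D_θ` on `B`) and integer coefficients `p` supported on `B`, not all zero, such that on the set-up
`TwoSetup.ofData …` with `Rᵢ = feldR i.1 H`, `uᵢ = i.2.1`, `u_θᵢ = i.2.2` the native identities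
`g3φ τ x = 0` hold for `|x| ≤ (d+2)X`, `|τ| ≤ (d+2)S₀`, and the record's `RecordTwo C (d+1) …` holds, then
`FrameTwoLast C d`. [cite: Nesterenko2003, §5.1; shape only] -/
theorem frameTwoLast_of_levels {C : ℕ → ℝ} {d : ℕ}
    (h : ∀ (α : Fin (d + 1) → ℚ) (b : Fin (d + 1) → ℤ) (V : Fin (d + 1) → ℝ) (Vmax W : ℝ)
      (hα : ∀ j, 3 ≤ padicValRat 2 (α j - 1)),
      (∀ μ : Fin (d + 1) → ℤ, ∏ j, α j ^ μ j = 1 → μ = 0) →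
      (∀ κ : Fin (d + 1) → ℤ, (∃ γ : ℚ, ∏ j, α j ^ κ j = γ ^ 3) → ∀ j, (3 : ℤ) ∣ κ j) →
      (∀ j, Height.logHeight₁ (α j) ≤ V j) → (∀ j, 1 ≤ V j) → (∀ j, V j ≤ Vmax) →
      ∀ (hb : b (Fin.last d) ≠ 0)
        (hmin : ∀ j, b j ≠ 0 → padicValInt 2 (b (Fin.last d)) ≤ padicValInt 2 (b j)),
      (∀ j, Real.log (max 3 (|b j| : ℝ)) ≤ W) → 1 ≤ W →
      ¬ (padicValRat 2 (∏ j, α j ^ b j - 1) : ℝ) ≤ C (d + 1) * (∏ j, V j) * (W + Real.log (2 * Vmax)) →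
      ∃ (H D₀ S₀ X : ℕ) (Dbox : Fin d → ℕ) (Dθ : ℕ) (B : Finset (ℕ × ((Fin d → ℤ) × ℤ)))
        (p : ℕ × ((Fin d → ℤ) × ℤ) → ℤ),
        (∀ i ∈ B, i.1 ≤ D₀) ∧ (∀ i ∈ B, ∀ j, |i.2.1 j| ≤ (Dbox j : ℤ)) ∧ (∀ i ∈ B, |i.2.2| ≤ (Dθ : ℤ)) ∧
        (∃ i ∈ B, p i ≠ 0) ∧
        (∀ x : ℤ, |x| ≤ (((d + 1 + 1) * X : ℕ) : ℤ) → ∀ τ : Tau d, tauNorm τ ≤ (d + 1 + 1) * S₀ →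
          (ofData d α b hα hb hmin).g3φ (fun i => feldR i.1 H) (fun i => i.2.1) (fun i => i.2.2) B p τ x
            = 0) ∧
        GenThreeFrameSpecTwo.RecordTwo C (d + 1) V Vmax W D₀ S₀ X (Fin.snoc Dbox Dθ)) :
    GenThreeFramePivotTwo.FrameTwoLast C d := by
  classical
  intro α b V Vmax W hα hind hK hV hV1 hVmax hb hmin hW hW1 hneg
  obtain ⟨H, D₀, S₀, X, Dbox, Dθ, B, p, hℓ, hu, huθ, ⟨i₀, hi₀, hpi₀⟩, hzero, hrec⟩ :=
    h α b V Vmax W hα hind hK hV hV1 hVmax hb hmin hW hW1 hneg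
  refine ⟨D₀, S₀, X, Fin.snoc Dbox Dθ, ?_, hrec⟩
  -- the family, with the binder types of `ofData`
  let S : TwoSetup := ofData d α b hα hb hmin
  let R : ℕ × ((Fin d → ℤ) × ℤ) → ℚ[X] := fun i => feldR i.1 H
  let u : ℕ × ((Fin d → ℤ) × ℤ) → Fin S.d → ℤ := fun i => i.2.1
  let uθ : ℕ × ((Fin d → ℤ) × ℤ) → ℤ := fun i => i.2.2
  have hR : ∀ i ∈ B, (R i).natDegree ≤ D₀ := fun i hi => (natDegree_feldR_le _ _).trans (hℓ i hi)
  have hu' : ∀ i ∈ B, ∀ j : Fin S.d, |u i j| ≤ (Dbox j : ℤ) := fun i hi j => hu i hi j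
  have huθ' : ∀ i ∈ B, |uθ i| ≤ (Dθ : ℤ) := fun i hi => huθ i hi
  refine frameOutputTwo_ofData α b hα hb hmin R u uθ B p hR hu' huθ' ?_ hzero
  -- the nonzero fibre: `allκ i = snoc i.2.1 i.2.2` determines `i.2`
  obtain ⟨κ₀, hκ₀⟩ := exists_fibre_ne_zero H B p hi₀ hpi₀
  refine ⟨Fin.snoc κ₀.1 κ₀.2, ?_⟩
  have hfilter : B.filter (fun i => S.allκ u uθ i = Fin.snoc κ₀.1 κ₀.2) = B.filter (fun i => i.2 = κ₀) := by
    refine Finset.filter_congr fun i _ => ?_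
    unfold allκ
    constructor
    · intro heq
      have h1 : i.2.1 = κ₀.1 := by
        funext j
        have := congrFun heq (Fin.castSucc j)
        simpa only [Fin.snoc_castSucc] using this
      have h2 : i.2.2 = κ₀.2 := by
        have := congrFun heq (Fin.last _)
        simpa only [Fin.snoc_last] using this
      exact Prod.ext h1 h2
    · intro heq
      show (Fin.snoc i.2.1 i.2.2 : Fin (d + 1) → ℤ) = Fin.snoc κ₀.1 κ₀.2
      rw [heq]
  rw [hfilter]
  exact hκ₀

end Summit.ABC.StewartYu.TwoSetup

end
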